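import Summits.PneNP.PneNP.Theorems.SymmetryBudgetRigidBenchmarkPlainLowerBound
import Summits.PneNP.PneNP.Theorems.NPNotSubsetPPoly
import Literature.Computability.Complexity.KarpProblems
import Literature.Computability.Complexity.ChromaticNP
import Literature.Computability.Complexity.CircuitClasses
import Literature.Computability.Complexity.CircuitClassesProofs
import Literature.Computability.Complexity.CircuitComposition
import Literature.Computability.Complexity.DeMorganSimulation
import Literature.Computability.Complexity.TM2PassThrough
import Literature.Computability.Complexity.CircuitLowerBounds

/-!
# Calibration of `SymmetryBudget.RigidBenchmark` (item stmt-PneNP-2149), III: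
# `RigidBenchmark → NPNotSubsetPPoly`

`SymmetryBudgetRigidBenchmarkPlainLowerBound.lean` shows that the benchmark implies a
superpolynomial lower bound for GENERAL `tcBasis`-circuits deciding 3-colourability of all
`m`-vertex graphs given by `m × m` matrices (`rigidBenchmark_not_threeColPolySize`). This file
closes the remaining gap to the tree's conjecture leaf `NPNotSubsetPPoly = ¬ (NP ⊆ P/poly)`
(`Theorems/NPNotSubsetPPoly.lean`):

* `threeColPolySize_of_CHROMATIC_mem_PPoly` — if Karp's language `CHROMATIC` (codes
  `⟨⟨⟨m, G⟩⟩, k⟩` of `k`-colourable graphs, `KarpProblems.lean`) has polynomial-size `B₂`-circuit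
  families, then 3-colourability of `Gr x` has polynomial-size `tcBasis`-circuits on matrix inputs
  at every `m`: hard-wire the code word of `(⟨m, Gr x⟩, 3)` — every bit of which is a constant or a
  symmetrised entry `x(i,j) ∨ x(j,i)` (`exists_word_template`) — in front of the circuit for the
  right length, and pass from `B₂` to `{∧₂, ∨₂, ¬} ⊆ tcBasis` (`Circuit.exists_deMorgan_of_B2`);
* `rigidBenchmark_imp_npNotSubsetPPoly` — hence, with `CHROMATIC ∈ NP`
  (`ChromaticNP.CHROMATIC_mem_NP`, proved in the tree): **`RigidBenchmark → NPNotSubsetPPoly`**.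

So the route's rigid-instance benchmark is formally AT LEAST AS STRONG as `NP ⊄ P/poly`: it is
not a cheaper target than the summit's own circuit-lower-bound conjecture (the converse,
`NP ⊄ P/poly → RigidBenchmark` via pendant-path rigidification, is the planner's informal claim
and is not formalised here).
-/

-- `Summit.PneNP.PneNP.…` duplicates `PneNP` BY DESIGN (single-problem summit, D-0017); the Summits
-- library sets this option globally (lakefile), repeated here so a standalone `lean check` is warning-free.
set_option linter.dupNamespace false

namespace Summit.PneNP.PneNP.Theorems

open Literature.Computability.Complexity _root_.Computability Polynomial Filter
open Summit.PneNP.PneNP.Theses.SymmetryBudget (RigidBenchmark)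
open scoped Classical

/-! ### The code word of `(⟨m, Gr x⟩, 3)` as a template over the adjacency bits -/

/-- Mapping a letter substitution over a paired word `x̂ 01 y` (bits of `x` doubled). -/
theorem map_dblPair {σ τ : Type} (φ : σ → τ) (x y : List σ) (f t : σ) :
    (x.flatMap (fun b => [b, b]) ++ [f, t] ++ y).map φ =
      (x.map φ).flatMap (fun b => [b, b]) ++ [φ f, φ t] ++ y.map φ := by
  simp [List.map_append, List.map_flatMap, List.flatMap_map]

/-- **Template of a doubly paired word.** The word `⟨⟨H, a⟩, K⟩ = boolPair (boolPair H a) K`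
is, uniformly in the middle block `a : Fin n → Bool`, the evaluation of one fixed template whose
letters are positions of `a` or constant bits. -/
theorem exists_word_template (H K : List Bool) (n : ℕ) :
    ∃ T : List (Fin n ⊕ Bool), ∀ a : Fin n → Bool,
      boolPair (boolPair H (List.ofFn a)) K = T.map (Sum.elim a _root_.id) := by
  refine ⟨(((H.map Sum.inr).flatMap (fun b => [b, b]) ++ [Sum.inr false, Sum.inr true] ++
      List.ofFn Sum.inl).flatMap (fun b => [b, b]) ++ [Sum.inr false, Sum.inr true] ++ K.map Sum.inr),
    fun a => ?_⟩
  rw [map_dblPair, map_dblPair]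
  have h1 : (Sum.elim a _root_.id ∘ Sum.inr : Bool → Bool) = _root_.id := funext fun b => rfl
  have h2 : (Sum.elim a _root_.id ∘ Sum.inl : Fin n → Bool) = a := funext fun i => rfl
  simp only [List.map_map, h1, h2, List.map_id, List.map_ofFn, Sum.elim_inr, id]
  rfl

/-- The adjacency bits of `Gr x` in the row-major order of `encodingGraphFin`. -/
theorem encodingGraphFin_encode_gr {m : ℕ} (x : Fin m × Fin m → Bool) :
    (encodingGraphFin m).encode (SymCR.Gr x) =
      List.ofFn fun k : Fin (m * m) =>
        decide ((SymCR.Gr x).Adj (finProdFinEquiv.symm k).1 (finProdFinEquiv.symm k).2) := by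
  unfold encodingGraphFin encodingBitVec
  simp only
  refine congrArg List.ofFn (funext fun k => ?_)
  exact decide_eq_decide.2 Iff.rfl

/-- **The code word of `(⟨m, Gr x⟩, 3)` in `CHROMATIC`'s encoding.** -/
theorem chromatic_encode_eq {m : ℕ} (x : Fin m × Fin m → Bool) :
    (encodingGraph.pairBool encodingNatBool).encode
        ((⟨m, SymCR.Gr x⟩ : Σ n, SimpleGraph (Fin n)), 3) =
      boolPair (boolPair (encodeNat m) (List.ofFn fun k : Fin (m * m) =>
        decide ((SymCR.Gr x).Adj (finProdFinEquiv.symm k).1 (finProdFinEquiv.symm k).2)))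
        (encodeNat 3) := by
  rw [← encodingGraphFin_encode_gr]
  show boolPair (encodingGraph.encode ⟨m, SymCR.Gr x⟩) (encodingNatBool.encode 3) = _
  rw [encodingGraph_encode]
  rfl

/-- Membership of that code word in `CHROMATIC` is 3-colourability of `Gr x`. -/
theorem chromatic_mem_iff {m : ℕ} (x : Fin m × Fin m → Bool) :
    (encodingGraph.pairBool encodingNatBool).encode
        ((⟨m, SymCR.Gr x⟩ : Σ n, SimpleGraph (Fin n)), 3) ∈ CHROMATIC ↔ (SymCR.Gr x).Colorable 3 := by
  unfold CHROMATIC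
  rw [Encoding.mem_toLanguage_iff]
  rfl

/-! ### Small circuits for the letters of the template -/

/-- The letter map: adjacency bits and constants, `x ↦ (k ↦ [Gr x ∋ e⁻¹ k], b ↦ b)`, costs at
most one `B₂`-gate per letter. -/
theorem cktSize_letters (m : ℕ) :
    CktSize B2 (fun (x : Fin m × Fin m → Bool) (s : Fin (m * m) ⊕ Bool) =>
      Sum.elim (fun k : Fin (m * m) =>
        decide ((SymCR.Gr x).Adj (finProdFinEquiv.symm k).1 (finProdFinEquiv.symm k).2)) _root_.id s)
      (Fintype.card (Fin (m * m) ⊕ Bool) * 1) := by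
  refine CktSize.pi_const fun s => ?_
  rcases s with k | b
  · simp only [Sum.elim_inl]
    by_cases hk : (finProdFinEquiv.symm k).1 = (finProdFinEquiv.symm k).2
    · refine (cktSize_const (Fin m × Fin m) false).congr fun x _ => ?_
      symm
      rw [decide_eq_false_iff_not, hk]
      exact (SymCR.Gr x).irrefl
    · refine (cktSize_or ((finProdFinEquiv.symm k).1, (finProdFinEquiv.symm k).2)
        ((finProdFinEquiv.symm k).2, (finProdFinEquiv.symm k).1)).congr fun x _ => ?_
      apply SymCR.eq_decide_of_iff
      rw [SimpleGraph.fromRel_adj, Bool.or_eq_true]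
      exact ⟨fun h => ⟨hk, h⟩, fun h => h.2⟩
  · exact (cktSize_const (Fin m × Fin m) b).congr fun _ _ => rfl

/-- `{∧₂, ∨₂, ¬} ⊆ tcBasis`. -/
theorem deMorganBasis_subset_tcBasis : deMorganBasis ⊆ tcBasis := by
  intro f hf
  simp only [deMorganBasis, Set.mem_insert_iff, Set.mem_singleton_iff] at hf
  refine acBasis_subset_tcBasis ?_
  rcases hf with rfl | rfl | rfl
  · exact Or.inr (Set.mem_iUnion.2 ⟨2, Or.inl rfl⟩)
  · exact Or.inr (Set.mem_iUnion.2 ⟨2, Or.inr rfl⟩)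
  · exact Or.inl rfl

/-- `|encodeNat n| ≤ n`. -/
theorem length_encodeNat_le_self (n : ℕ) : (encodeNat n).length ≤ n := by
  rw [TM2Pass.length_encodeNat_eq_size]
  exact Nat.size_le.2 (Nat.lt_two_pow_self)

/-! ### From a circuit family for `CHROMATIC` to matrix circuits for 3-colourability -/

/-- **One input length.** From a `B₂`-circuit `C` deciding `CHROMATIC` on words of the length
`N` of the codes of `m`-vertex instances with `k = 3`, a `tcBasis`-circuit on `m × m` matrices
computing `x ↦ [Gr x is 3-colourable]`, of size at most `12·(m² + 2 + |C|) + 4`. -/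
theorem exists_threeCol_circuit_of_decides {m : ℕ} (C : CircuitFamily)
    (hCB : ∀ n, (C n).IsOver B2) (hCd : C.Decides CHROMATIC) :
    ∃ D : Circuit (Fin m × Fin m), D.IsOver tcBasis ∧
      D.size ≤ 12 * (m * m + 2 + (C (2 * (2 * (encodeNat m).length + 2 + m * m) + 2 +
        (encodeNat 3).length)).size) + 4 ∧
      D.Computes (fun x => decide ((SymCR.Gr x).Colorable 3)) := by
  -- the template and the word
  obtain ⟨T, hT⟩ := exists_word_template (encodeNat m) (encodeNat 3) (m * m)
  set N : ℕ := 2 * (2 * (encodeNat m).length + 2 + m * m) + 2 + (encodeNat 3).length with hN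
  have hTl : T.length = N := by
    have := congrArg List.length (hT fun _ => false)
    simp only [length_boolPair, List.length_ofFn, List.length_map] at this
    omega
  let adj : (Fin m × Fin m → Bool) → Fin (m * m) → Bool := fun x k =>
    decide ((SymCR.Gr x).Adj (finProdFinEquiv.symm k).1 (finProdFinEquiv.symm k).2)
  let word : (Fin m × Fin m → Bool) → List Bool := fun x =>
    boolPair (boolPair (encodeNat m) (List.ofFn (adj x))) (encodeNat 3)
  have hword : ∀ x, word x = T.map (Sum.elim (adj x) _root_.id) := fun x => hT (adj x)
  have hwl : ∀ x, (word x).length = N := fun x => by rw [hword, List.length_map, hTl]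
  -- semantics of the family on words of length `N`
  have key : ∀ (n : ℕ) (w : List Bool) (hw : w.length = n),
      (C n).eval (fun i => w.get (i.cast hw.symm)) = CHROMATIC.boolIndicator w := by
    intro n w hw
    subst hw
    exact hCd w
  have hsem : ∀ x, (C N).eval (fun i => Sum.elim (adj x) _root_.id (T.get (i.cast hTl.symm))) =
      decide ((SymCR.Gr x).Colorable 3) := by
    intro x
    have h1 : (fun i : Fin N => Sum.elim (adj x) _root_.id (T.get (i.cast hTl.symm))) =
        fun i => (word x).get (i.cast (hwl x).symm) := by
      funext i
      have hi1 : (i : ℕ) < (word x).length := by rw [hwl x]; exact i.2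
      have hi2 : (i : ℕ) < (T.map (Sum.elim (adj x) _root_.id)).length := by
        rw [List.length_map, hTl]; exact i.2
      show Sum.elim (adj x) _root_.id (T[(i : ℕ)]'(by rw [hTl]; exact i.2)) = (word x)[(i : ℕ)]'hi1
      rw [List.getElem_of_eq (hword x) hi1, List.getElem_map]
    rw [h1, key N (word x) (hwl x)]
    apply SymCR.eq_decide_of_iff
    rw [← Set.mem_iff_boolIndicator, ← chromatic_mem_iff x, chromatic_encode_eq]
    exact Iff.rfl
  -- the `B₂` program: letters, then `C N`
  have hL := (cktSize_letters m).outMap (fun i : Fin N => T.get (i.cast hTl.symm))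
  have hP := hL.comp ((C N).cktSize_eval (hCB N))
  have hcard : Fintype.card (Fin (m * m) ⊕ Bool) * 1 = m * m + 2 := by simp
  rw [hcard] at hP
  -- to `tcBasis`
  rcases Nat.eq_zero_or_pos m with rfl | hm
  · -- no inputs: the constant `true`
    let e0 : Fin (GateFn.and 0).1 ≃ Fin 0 × Fin 0 := Equiv.equivOfIsEmpty (Fin 0) (Fin 0 × Fin 0)
    refine ⟨Circuit.single (GateFn.and 0) e0,
      Circuit.single_isOver (acBasis_subset_tcBasis (Or.inr (Set.mem_iUnion.2 ⟨0, Or.inl rfl⟩))) _,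
      by simp, fun x => ?_⟩
    rw [Circuit.eval_single]
    have hc : (SymCR.Gr x).Colorable 3 := SimpleGraph.Colorable.of_isEmpty 3
    simp [GateFn.and, hc]
  · have hdM := hP.deMorgan_of_B2 ((⟨0, hm⟩ : Fin m), (⟨0, hm⟩ : Fin m))
    obtain ⟨D, hDB, hDs, hDe⟩ := (hdM.basis_mono deMorganBasis_subset_tcBasis).toCircuit
    refine ⟨D, hDB, by omega, fun x => ?_⟩
    rw [hDe x]
    exact hsem x

/-- **`CHROMATIC ∈ P/poly` gives polynomial-size matrix circuits for 3-colourability.** -/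
theorem threeColPolySize_of_CHROMATIC_mem_PPoly (h : CHROMATIC ∈ PPoly) :
    ∃ q : Polynomial ℕ, ∀ m : ℕ, ∃ D : Circuit (Fin m × Fin m), D.IsOver tcBasis ∧
      D.size ≤ q.eval m ∧ D.Computes (fun x : Fin m × Fin m → Bool =>
        decide ((SimpleGraph.fromRel fun u v => x (u, v) = true : SimpleGraph (Fin m)).Colorable 3)) := by
  obtain ⟨p, C, hC, hCd⟩ := Set.mem_iUnion.1 h
  refine ⟨12 * (X * X + 2 + p.comp (2 * X * X + 4 * X + 8)) + 4, fun m => ?_⟩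
  obtain ⟨D, hDB, hDs, hDc⟩ := exists_threeCol_circuit_of_decides (m := m) C (fun n => (hC n).1) hCd
  refine ⟨D, hDB, hDs.trans ?_, hDc⟩
  have h3 : (encodeNat 3).length = 2 := by decide
  have hlen := length_encodeNat_le_self m
  have hsize := (hC (2 * (2 * (encodeNat m).length + 2 + m * m) + 2 + (encodeNat 3).length)).2
  have hmono := natPoly_eval_mono p
    (show 2 * (2 * (encodeNat m).length + 2 + m * m) + 2 + (encodeNat 3).length ≤
      2 * m * m + 4 * m + 8 by rw [h3]; nlinarith)
  have heval : (12 * (X * X + 2 + p.comp (2 * X * X + 4 * X + 8)) + 4 : Polynomial ℕ).eval m =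
      12 * (m * m + 2 + p.eval (2 * m * m + 4 * m + 8)) + 4 := by
    simp [eval_comp]
  rw [heval]
  have := hsize.trans hmono
  omega

/-- **The benchmark is at least as strong as `NP ⊄ P/poly`.** `RigidBenchmark → NPNotSubsetPPoly`:
if `NP ⊆ P/poly` then `CHROMATIC ∈ P/poly` (`CHROMATIC ∈ NP`, proved in the tree), so
3-colourability has polynomial-size matrix circuits, which `RigidBenchmark` forbids
(`rigidBenchmark_not_threeColPolySize`: symmetric colour-refinement canonisation compiles them
into fully symmetric circuits correct on CR-discrete inputs). -/
theorem rigidBenchmark_imp_npNotSubsetPPoly (h : RigidBenchmark) : NPNotSubsetPPoly := by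
  intro hsub
  exact rigidBenchmark_not_threeColPolySize h
    (threeColPolySize_of_CHROMATIC_mem_PPoly (hsub ChromaticNP.CHROMATIC_mem_NP))

end Summit.PneNP.PneNP.Theorems
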